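import Summits.AtomisticToContinuum.Crystallization.Theorems.OverbindingBudgetAffineCompressedCutChartsA

/-!
# OverbindingBudget / affine run cut — chart-to-integer rounding («D1-SHEET», consumption helpers for (35n))

Leaf SW♭ (`…OverbindingBudgetAffineRunCutFlat.StackSwapGainFlatWide`), crux `RobustDefectLimitWindows`
(stmt-AtomisticToContinuum-31280); memo SW-CHI §10.10 (lens-4 g87).

The local crossing-exclusion certificate `…RunCutCrossLocal.cross_local_layer_rigid` is stated over EXACT integer data:
a map `φ` of known sites to pattern labels preserving `tsq` (shell) and short mutual `tsq`.  These helpers turn CHART data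
(an affine frame `A` that is `θ`-close to a linear isometry `Q` on the pattern, sites matched within `η·ν`) into such exact
equalities:
* `chart_pair_dist`: two sites matched to pattern vectors `v, w` of ONE chart are at distance `ν‖v − w‖ ± (2θ + 2η)ν`;
* `model_dist_close`: the same physical distance read in TWO charts (scales `ν₁`, `ν₂ = r ν₁`) gives model distances
  `D, D′` with `|D − D′| ≤ e₁ + e₂ r + |1 − r|·|D′|`;
* `tsq_eq_of_sq_close`: if `D² = t/18`, `D′² = t′/18` (integers `t, t′` — `norm_mv_sub_sq`) and `18·δ·S < 1` where
  `|D − D′| ≤ δ`, `|D + D′| ≤ S`, then `t = t′` (`int_eq_of_abs_sub_lt_one`).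
With `θ = 10⁻³`, `η = 10⁻⁴`, `r ∈ [0.9978, 1.0022]`: shells (`D ≤ 1.5`) give `18·3·0.0067 = 0.36 < 1`, short pairs (`D ≤ 2`)
`18·4·0.0089 = 0.64 < 1` — the arithmetic instances `round_shell_inst`, `round_pair_inst`.

[this file: 0 definitions, 7 theorems; imports TREE `…CompressedCutChartsA` only; standard axioms]
-/

namespace Summit.AtomisticToContinuum.Crystallization.Theorems.OverbindingBudgetAffineRunCutCrossRound

open Summit.AtomisticToContinuum.Crystallization.Theorems.OverbindingBudgetAffineCompressedCutKernel (T3 tsub tsq)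
open Summit.AtomisticToContinuum.Crystallization.Theorems.OverbindingBudgetAffineCompressedCutCharts (mv mv_tsub norm_mv_sq)

local notation "E3" => EuclideanSpace ℝ (Fin 3)

/-- Integers at real distance `< 1` are equal. [this file] -/
theorem int_eq_of_abs_sub_lt_one {t t' : ℤ} (h : |((t : ℝ) - t')| < 1) : t = t' := by
  have h1 : ((t - t' : ℤ) : ℝ) < (1 : ℤ) := by push_cast; linarith [le_abs_self ((t : ℝ) - t')]
  have h2 : ((-1 : ℤ) : ℝ) < ((t - t' : ℤ) : ℝ) := by push_cast; linarith [neg_abs_le ((t : ℝ) - t')]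
  have h1' : t - t' < 1 := by exact_mod_cast h1
  have h2' : -1 < t - t' := by exact_mod_cast h2
  omega

/-- ★ Rounding: two model distances whose squares are `t/18`, `t′/18` and which are close agree on the integer. [this file] -/
theorem tsq_eq_of_sq_close {t t' : ℤ} {D D' δ S : ℝ} (ht : D ^ 2 = (t : ℝ) / 18) (ht' : D' ^ 2 = (t' : ℝ) / 18)
    (hδ : |D - D'| ≤ δ) (hS : |D + D'| ≤ S) (h : 18 * δ * S < 1) : t = t' := by
  apply int_eq_of_abs_sub_lt_one
  have e : (t : ℝ) - t' = 18 * ((D - D') * (D + D')) := by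
    have e1 : (t : ℝ) = 18 * D ^ 2 := by rw [ht]; ring
    have e2 : (t' : ℝ) = 18 * D' ^ 2 := by rw [ht']; ring
    rw [e1, e2]; ring
  rw [e, abs_mul, abs_mul, abs_of_pos (by norm_num : (0 : ℝ) < 18)]
  have hδ0 : 0 ≤ δ := le_trans (abs_nonneg _) hδ
  calc 18 * (|D - D'| * |D + D'|) ≤ 18 * (δ * S) :=
        mul_le_mul_of_nonneg_left (mul_le_mul hδ hS (abs_nonneg _) hδ0) (by norm_num)
    _ < 1 := by linarith

/-- Model distance of two pattern labels: `‖mv V − mv W‖² = tsq (V − W)/18`. [this file; `mv_tsub`, `norm_mv_sq`] -/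
theorem norm_mv_sub_sq (V W : T3) : ‖mv V - mv W‖ ^ 2 = (tsq (tsub V W) : ℝ) / 18 := by
  rw [← mv_tsub, norm_mv_sq]

/-- ★ Chart pair-distance lemma: sites `a, b` matched to the pattern vectors `v, w` of one chart (centre `c`, scale `ν`,
frame `A` with `‖A u − Q u‖ ≤ θ` at `u = v, w`, `Q` a linear isometry, matching radius `η ν`) are at distance
`ν‖v − w‖` up to `(2θ + 2η)ν`. [this file] -/
theorem chart_pair_dist {Q : E3 →ₗᵢ[ℝ] E3} {A : E3 →ₗ[ℝ] E3} {c a b v w : E3} {ν θ η : ℝ} (hν : 0 ≤ ν)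
    (hv : ‖A v - Q v‖ ≤ θ) (hw : ‖A w - Q w‖ ≤ θ)
    (ha : dist a (c + ν • A v) ≤ η * ν) (hb : dist b (c + ν • A w) ≤ η * ν) :
    |dist a b - ν * ‖v - w‖| ≤ (2 * θ + 2 * η) * ν := by
  set p := c + ν • A v with hp
  set q := c + ν • A w with hq
  have h1 : dist p q = ν * ‖A v - A w‖ := by
    rw [dist_eq_norm, hp, hq, add_sub_add_left_eq_sub, ← smul_sub, norm_smul, Real.norm_of_nonneg hν]
  have h2 : |‖A v - A w‖ - ‖v - w‖| ≤ 2 * θ := by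
    have hQ : ‖Q v - Q w‖ = ‖v - w‖ := by rw [← map_sub, LinearIsometry.norm_map]
    rw [← hQ]
    have h := abs_norm_sub_norm_le (A v - A w) (Q v - Q w)
    have e : A v - A w - (Q v - Q w) = (A v - Q v) - (A w - Q w) := by abel
    rw [e] at h
    linarith [norm_sub_le (A v - Q v) (A w - Q w)]
  have h3 : |dist a b - dist p q| ≤ dist a p + dist b q := by
    rw [abs_le]
    constructor
    · linarith [dist_triangle p a q, dist_triangle a b q, dist_comm p a, dist_comm b q]
    · linarith [dist_triangle a p b, dist_triangle p q b, dist_comm q b]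
  have h4 : |dist p q - ν * ‖v - w‖| ≤ 2 * θ * ν := by
    rw [h1, ← mul_sub, abs_mul, abs_of_nonneg hν]
    calc ν * |‖A v - A w‖ - ‖v - w‖| ≤ ν * (2 * θ) := mul_le_mul_of_nonneg_left h2 hν
      _ = 2 * θ * ν := by ring
  have e : dist a b - ν * ‖v - w‖ = (dist a b - dist p q) + (dist p q - ν * ‖v - w‖) := by ring
  rw [e]
  calc |(dist a b - dist p q) + (dist p q - ν * ‖v - w‖)|
        ≤ |dist a b - dist p q| + |dist p q - ν * ‖v - w‖| := abs_add_le _ _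
    _ ≤ (dist a p + dist b q) + 2 * θ * ν := add_le_add h3 h4
    _ ≤ (η * ν + η * ν) + 2 * θ * ν := by linarith
    _ = (2 * θ + 2 * η) * ν := by ring

/-- ★ Two charts reading one physical distance `d`: scales `ν₁ > 0` and `ν₂ = r·ν₁`, model distances `D, D′`, chart
accuracies `e₁ ν₁`, `e₂ ν₂`.  Then `|D − D′| ≤ e₁ + e₂·r + |1 − r|·|D′|`. [this file] -/
theorem model_dist_close {d ν₁ ν₂ r D D' e₁ e₂ : ℝ} (hν₁ : 0 < ν₁) (hr : ν₂ = r * ν₁)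
    (h1 : |d - ν₁ * D| ≤ e₁ * ν₁) (h2 : |d - ν₂ * D'| ≤ e₂ * ν₂) :
    |D - D'| ≤ e₁ + e₂ * r + |1 - r| * |D'| := by
  have hA : |ν₁ * D - ν₂ * D'| ≤ e₁ * ν₁ + e₂ * ν₂ := by
    have e : ν₁ * D - ν₂ * D' = (d - ν₂ * D') - (d - ν₁ * D) := by ring
    rw [e]
    exact le_trans (abs_sub _ _) (by linarith)
  have hB : |D - r * D'| ≤ e₁ + e₂ * r := by
    have e : ν₁ * D - ν₂ * D' = ν₁ * (D - r * D') := by rw [hr]; ring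
    rw [e, abs_mul, abs_of_pos hν₁, hr] at hA
    have : ν₁ * |D - r * D'| ≤ ν₁ * (e₁ + e₂ * r) := by linarith
    exact le_of_mul_le_mul_left this hν₁
  have hC : |r * D' - D'| = |1 - r| * |D'| := by
    have e : r * D' - D' = -((1 - r) * D') := by ring
    rw [e, abs_neg, abs_mul]
  calc |D - D'| = |(D - r * D') + (r * D' - D')| := by ring_nf
    _ ≤ |D - r * D'| + |r * D' - D'| := abs_add_le _ _
    _ ≤ (e₁ + e₂ * r) + |1 - r| * |D'| := by rw [hC]; exact add_le_add hB le_rfl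

/-- Arithmetic of the SHELL rounding (memo §10.10 (ii)): accuracies `0.0022`, `0.0011`, ratio within `0.0022` of 1,
`D′ ≤ 1.5`, sum `≤ 3` ⇒ `18·δ·S < 1`. [this file] -/
theorem round_shell_inst : 18 * ((22 / 10 ^ 4 : ℝ) + 11 / 10 ^ 4 * (10022 / 10 ^ 4) + 22 / 10 ^ 4 * (3 / 2)) * 3 < 1 := by
  norm_num

/-- Arithmetic of the SHORT-PAIR rounding (memo §10.10 (iii)): accuracies `0.0022` in both charts, ratio within `0.0022`
of 1, `D′ ≤ 2`, sum `≤ 4` ⇒ `18·δ·S < 1` (`= 0.64…`). [this file] -/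
theorem round_pair_inst : 18 * ((22 / 10 ^ 4 : ℝ) + 22 / 10 ^ 4 * (10022 / 10 ^ 4) + 22 / 10 ^ 4 * 2) * 4 < 1 := by
  norm_num

end Summit.AtomisticToContinuum.Crystallization.Theorems.OverbindingBudgetAffineRunCutCrossRound
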